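import Literature.Computability.AlgebraicComplexity.FormSingularLocusSubfamily
import Literature.Computability.AlgebraicComplexity.FormDiscriminantHomogeneous
import Literature.RingTheory.KrullDimension.TranscendenceDegreeOfPoint
import Literature.RingTheory.KrullDimension.AffineCatenary
import Mathlib.RingTheory.Localization.FractionRing
import Mathlib.RingTheory.MvPolynomial.Tower
import HarnessLib

/-!
# The singular forms of degree `D` form a hypersurface (the discriminant locus, II): height one,
# and the discriminant exists

Topic `Literature/Computability/AlgebraicComplexity` (cell `val-lit`, row BI2017-A, programme
"`BI2017_prop_2_10` without Popov", brick (3): existence of the discriminant). Theorems only — no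
definition, no named fact. Continuation of `FormSingularLocusPrime.lean` (part I: the ideal
`I_S = ker (Φ ↦ Φ(singFamilyCoeff))` of polynomial functions on `Sym^D ℂ^{n+2}` vanishing on all
singular forms is a non-zero prime) and `FormSingularLocusSubfamily.lean` (part IIa: a sub-family of
singular forms with `N − 1` algebraically independent coefficient functions, `N = dim Sym^D`):

* `FormDiscriminant.height_ker_singFamily_le_one` / `height_ker_singFamily_eq_one` — **`height I_S = 1`**:
  `trdeg ≤ dim` for the image of the sub-family's comorphism
  (`KrullDimension.toNat_trdeg_adjoin_le_ringKrullDim_quotient`, Deligne's Lemma 1.7) gives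
  `dim ℂ[Sym^D]/I_S ≥ N − 1`, and the dimension formula `dim (ℂ[Sym^D]/I_S) + height I_S = N`
  (`AffineCatenary`) gives `height ≤ 1`; `≠ ⊥` gives `= 1`. So the discriminant locus is an
  irreducible HYPERSURFACE (Gelfand–Kapranov–Zelevinsky Ch. 1 §1).
* The last section discharges the hypothesis `height I_S ≤ 1` of the packaged statements of
  `FormDiscriminantExists.lean` / `FormDiscriminantHomogeneous.lean` (cell val-lit, p5 g5):
  **the discriminant exists** — `FormDiscriminant.exists_discriminant`, `exists_prime_discriminant`,
  `exists_homogeneous_isSLInvariantCoord_discriminant`, `exists_prime_isHomogeneous_discriminant`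
  (a non-zero / prime, homogeneous, `SL_{n+2}`-invariant polynomial in the coefficients vanishing at
  a form of degree `D ≥ 2` in `n + 2 ≥ 2` variables iff the form is not nonsingular;
  Mumford–Fogarty–Kirwan Prop. 4.2, proof: «a definite homogeneous polynomial `Δ` in its
  coefficients … `Δ` must be invariant»).

Honest framing: classical algebraic geometry; nothing here bears on `VP ≠ VNP`.

## References

* I. M. Gelfand, M. M. Kapranov, A. V. Zelevinsky, *Discriminants, Resultants, and
  Multidimensional Determinants* (1994), Ch. 1 §1. [GelfandKapranovZelevinsky1994]
* D. Mumford, J. Fogarty, F. Kirwan, *Geometric Invariant Theory*, 3rd ed., Ch. 4 §2, Prop. 4.2.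
  [MumfordFogartyKirwan1994]
-/

noncomputable section

open MvPolynomial

namespace Literature.Computability.AlgebraicComplexity

open Literature.AlgebraicGeometry.Motives.SmoothHypersurface

namespace FormDiscriminant

variable {n D : ℕ}

/-! ### Height one -/

section Height

open Literature.RingTheory.KrullDimension

/-- The number of degree-`D` monomials `N = dim Sym^D ℂ^{n+2}` is the number of parameters of the
sub-family plus one (the only missing exponent is `x₀^D`). [folklore] -/
private theorem card_uVars_add_one (hD : 1 ≤ D) :
    Fintype.card (UVars n D) + 1 = Fintype.card (DegIdx (Fin (n + 2)) D) := by
  classical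
  -- `UVars ≃ {e : DegIdx // e ≠ x₀^D}` via `uExp`
  let top : DegIdx (Fin (n + 2)) D := ⟨Finsupp.single 0 D, mem_degMonomials_iff.2 (by simp)⟩
  have hexp : ∀ v : UVars n D, (uExp v).degree = D := by
    rintro (e | k)
    · exact mem_degMonomials_iff.1 e.1.2
    · simp only [uExp, Sum.elim_inr, map_add, Finsupp.degree_single]; omega
  have hne : ∀ v : UVars n D, (⟨uExp v, mem_degMonomials_iff.2 (hexp v)⟩ : DegIdx (Fin (n + 2)) D)
      ≠ top := by
    rintro (e | k) h
    · have h2 := e.2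
      have : e.1.1 = Finsupp.single 0 D := congrArg Subtype.val h
      rw [this, Finsupp.single_eq_same] at h2
      omega
    · have : (Finsupp.single 0 (D - 1) + Finsupp.single k.succ 1 : Fin (n + 2) →₀ ℕ) k.succ =
          (Finsupp.single 0 D : Fin (n + 2) →₀ ℕ) k.succ :=
        congrArg (fun f : Fin (n + 2) →₀ ℕ => f k.succ) (congrArg Subtype.val h)
      rw [Finsupp.add_apply, Finsupp.single_eq_same, Finsupp.single_eq_of_ne (Fin.succ_ne_zero k),
        Finsupp.single_eq_of_ne (Fin.succ_ne_zero k)] at this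
      omega
  let emb : UVars n D → {e : DegIdx (Fin (n + 2)) D // e ≠ top} := fun v =>
    ⟨⟨uExp v, mem_degMonomials_iff.2 (hexp v)⟩, hne v⟩
  have hbij : Function.Bijective emb := by
    constructor
    · rintro (e | k) (e' | k') h
      · have := congrArg (fun x : {e : DegIdx (Fin (n + 2)) D // e ≠ top} => x.1.1) h
        simp only [emb, uExp, Sum.elim_inl] at this
        rw [Subtype.ext (Subtype.ext this)]
      · exfalso
        have := congrArg (fun x : {e : DegIdx (Fin (n + 2)) D // e ≠ top} => x.1.1 0) h
        simp only [emb, uExp, Sum.elim_inl, Sum.elim_inr, Finsupp.add_apply, Finsupp.single_eq_same,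
          Finsupp.single_eq_of_ne (Fin.succ_ne_zero k').symm, add_zero] at this
        have h2 := e.2
        omega
      · exfalso
        have := congrArg (fun x : {e : DegIdx (Fin (n + 2)) D // e ≠ top} => x.1.1 0) h
        simp only [emb, uExp, Sum.elim_inl, Sum.elim_inr, Finsupp.add_apply, Finsupp.single_eq_same,
          Finsupp.single_eq_of_ne (Fin.succ_ne_zero k).symm, add_zero] at this
        have h2 := e'.2
        omega
      · have := congrArg (fun x : {e : DegIdx (Fin (n + 2)) D // e ≠ top} => x.1.1 k.succ) h
        simp only [emb, uExp, Sum.elim_inr, Finsupp.add_apply, Finsupp.single_eq_same,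
          Finsupp.single_eq_of_ne (Fin.succ_ne_zero k)] at this
        by_cases hkk : k = k'
        · rw [hkk]
        · rw [Finsupp.single_eq_of_ne (fun h' => hkk (Fin.succ_injective _ h'))] at this
          omega
    · rintro ⟨d, hd⟩
      have hdeg : d.1.degree = D := mem_degMonomials_iff.1 d.2
      by_cases hfree : d.1 0 + 2 ≤ D
      · exact ⟨Sum.inl ⟨d, hfree⟩, rfl⟩
      · -- `d 0 = D - 1`: `d = (D-1)e₀ + e_{k+1}`
        have hsum : d.1.degree = d.1 0 + ∑ k : Fin (n + 1), d.1 k.succ := by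
          rw [Finsupp.degree_eq_sum, Fin.sum_univ_succ]
        rw [hdeg] at hsum
        have hd0 : d.1 0 ≠ D := by
          intro h0
          apply hd
          apply Subtype.ext
          show d.1 = Finsupp.single 0 D
          ext i
          by_cases hi : i = 0
          · subst hi; rw [Finsupp.single_eq_same, h0]
          · obtain ⟨i', rfl⟩ := Fin.exists_succ_eq.2 hi
            rw [Finsupp.single_eq_of_ne (Fin.succ_ne_zero i')]
            have := Finset.single_le_sum (fun i _ => Nat.zero_le (d.1 (Fin.succ i)))
              (Finset.mem_univ i')
            omega
        have hrest : ∑ k : Fin (n + 1), d.1 k.succ = 1 := by omega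
        obtain ⟨k₀, hk₀⟩ : ∃ k₀ : Fin (n + 1), d.1 k₀.succ ≠ 0 := by
          by_contra hcon
          push Not at hcon
          rw [Finset.sum_eq_zero fun i _ => hcon i] at hrest
          exact zero_ne_one hrest
        have hk₀le := Finset.single_le_sum (fun i _ => Nat.zero_le (d.1 (Fin.succ i)))
          (Finset.mem_univ k₀)
        have hothers : ∀ i : Fin (n + 1), i ≠ k₀ → d.1 i.succ = 0 := by
          intro i hi
          have := Finset.add_le_sum (fun i _ => Nat.zero_le (d.1 (Fin.succ i))) (Finset.mem_univ i)
            (Finset.mem_univ k₀) hi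
          omega
        refine ⟨Sum.inr k₀, Subtype.ext (Subtype.ext ?_)⟩
        show Finsupp.single 0 (D - 1) + Finsupp.single k₀.succ 1 = d.1
        ext i
        rw [Finsupp.add_apply]
        by_cases hi : i = 0
        · subst hi
          rw [Finsupp.single_eq_same, Finsupp.single_eq_of_ne (Fin.succ_ne_zero k₀).symm]
          omega
        · obtain ⟨i', rfl⟩ := Fin.exists_succ_eq.2 hi
          rw [Finsupp.single_eq_of_ne (Fin.succ_ne_zero i')]
          by_cases hii : i' = k₀
          · subst hii; rw [Finsupp.single_eq_same]; omega
          · rw [Finsupp.single_eq_of_ne (fun h => hii (Fin.succ_injective _ h)), hothers i' hii,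
              add_zero]
  rw [Fintype.card_of_bijective hbij, Fintype.card_subtype_compl, Fintype.card_subtype_eq]
  have : 1 ≤ Fintype.card (DegIdx (Fin (n + 2)) D) :=
    Fintype.card_pos_iff.2 ⟨top⟩
  omega

/-- **`dim (ℂ[Sym^D] ⧸ I_S) ≥ N − 1`**: the cokernel of the sub-family's comorphism has dimension at
least the transcendence degree of its image, which contains `N − 1` algebraically independent
coefficient functions. [cite: GelfandKapranovZelevinsky1994, Ch. 1 §1 (the discriminant hypersurface)] -/
theorem card_uVars_le_ringKrullDim_quotient_ker_singFamily (hD : 2 ≤ D) :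
    (Fintype.card (UVars n D) : WithBot ℕ∞) ≤
      ringKrullDim (MvPolynomial (DegIdx (Fin (n + 2)) D) ℂ ⧸
        RingHom.ker (aeval (R := ℂ) (singFamilyCoeff (n := n) (D := D))).toRingHom) := by
  classical
  -- work with the `L`-valued point `z = uFamilyCoeff` in the fraction field of `ℂ[c, b]`
  let P := MvPolynomial (UVars n D) ℂ
  let L := FractionRing P
  let z : DegIdx (Fin (n + 2)) D → L := fun d => algebraMap P L (uFamilyCoeff d)
  have hz : ∀ p ∈ RingHom.ker (aeval (R := ℂ) (singFamilyCoeff (n := n) (D := D))).toRingHom,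
      aeval z p = 0 := by
    intro p hp
    have hp' := ker_singFamily_le_ker_uFamily hp
    rw [RingHom.mem_ker, AlgHom.toRingHom_eq_coe, RingHom.coe_coe] at hp'
    have : aeval z p = algebraMap P L (aeval (R := ℂ) (uFamilyCoeff (n := n) (D := D)) p) :=
      MvPolynomial.aeval_algebraMap_apply L (uFamilyCoeff (n := n) (D := D)) p
    rw [this, hp', map_zero]
  refine le_trans ?_ (toNat_trdeg_adjoin_le_ringKrullDim_quotient z hz)
  -- the adjoined field contains `N − 1` algebraically independent elements
  rw [trdeg_intermediateFieldAdjoin_eq]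
  set A : Subalgebra ℂ L := Algebra.adjoin ℂ (Set.range z) with hA
  have hexp : ∀ v : UVars n D, (uExp v).degree = D := by
    rintro (e | k)
    · exact mem_degMonomials_iff.1 e.1.2
    · simp only [uExp, Sum.elim_inr, map_add, Finsupp.degree_single]; omega
  have hmem : ∀ v : UVars n D, algebraMap P L (uJacFamily v) ∈ A := fun v =>
    Algebra.subset_adjoin ⟨⟨uExp v, mem_degMonomials_iff.2 (hexp v)⟩, rfl⟩
  let g : UVars n D → A := fun v => ⟨algebraMap P L (uJacFamily v), hmem v⟩
  have hg : AlgebraicIndependent ℂ g := by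
    refine AlgebraicIndependent.of_comp A.val ?_
    have : (A.val : A → L) ∘ g = (IsScalarTower.toAlgHom ℂ P L) ∘ uJacFamily := by
      funext v; rfl
    rw [this]
    exact (algebraicIndependent_uJacFamily hD).map' (IsFractionRing.injective P L)
  haveI : Algebra.FiniteType ℂ A :=
    (Subalgebra.fg_iff_finiteType A).1 ⟨(Set.finite_range z).toFinset, by
      rw [Set.Finite.coe_toFinset]⟩
  have hle := hg.lift_cardinalMk_le_trdeg
  rw [Cardinal.mk_fintype, Cardinal.lift_natCast, Cardinal.lift_id,
    trdeg_eq_toNat ℂ A, Nat.cast_le] at hle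
  exact_mod_cast hle

/-- **The singular forms of degree `D ≥ 2` in `n + 2 ≥ 2` variables form (the closure of) a family of
codimension at most one: `height I_S ≤ 1`** for the prime ideal `I_S` of polynomial functions on
`Sym^D ℂ^{n+2}` vanishing on all singular forms. With part I (`I_S` prime, `I_S ≠ ⊥`) the height is
exactly one: the discriminant locus is an irreducible hypersurface (GKZ Ch. 1 §1; "the variety of
singular forms has codimension one", the generic singular form having a single singular point).
[cite: GelfandKapranovZelevinsky1994, Ch. 1 §1 (the discriminant hypersurface)] -/
theorem height_ker_singFamily_le_one (hD : 2 ≤ D) :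
    (RingHom.ker (aeval (R := ℂ) (singFamilyCoeff (n := n) (D := D))).toRingHom).height ≤ 1 := by
  classical
  set I := RingHom.ker (aeval (R := ℂ) (singFamilyCoeff (n := n) (D := D))).toRingHom with hI
  haveI hIp : I.IsPrime := isPrime_ker_singFamily
  -- dimension formula `dim (R ⧸ I) + height I = dim R = N`
  have hdim := ringKrullDim_quotient_add_height (F := ℂ) I
  have hR : ringKrullDim (MvPolynomial (DegIdx (Fin (n + 2)) D) ℂ) =
      (Fintype.card (DegIdx (Fin (n + 2)) D) : WithBot ℕ∞) := by
    rw [MvPolynomial.ringKrullDim_of_isNoetherianRing, ringKrullDim_eq_zero_of_field, zero_add,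
      Nat.card_eq_fintype_card]
  rw [hR] at hdim
  -- the quotient is an affine domain of some dimension `s`
  obtain ⟨s, hs, -⟩ := exists_ringKrullDim_eq_and_trdeg_eq ℂ
    (MvPolynomial (DegIdx (Fin (n + 2)) D) ℂ ⧸ I)
  rw [hs] at hdim
  -- the height is finite
  have hht : I.height ≠ ⊤ := Ideal.height_ne_top_of_isPrime
  obtain ⟨h, hh⟩ := ENat.ne_top_iff_exists.1 hht
  rw [← hh] at hdim ⊢
  -- `s ≥ N - 1`
  have hlow := card_uVars_le_ringKrullDim_quotient_ker_singFamily (n := n) (D := D) hD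
  rw [← hI, hs] at hlow
  have hcard := card_uVars_add_one (n := n) (D := D) (by omega)
  have h1 : s + h = Fintype.card (DegIdx (Fin (n + 2)) D) := by
    have : ((s + h : ℕ) : WithBot ℕ∞) = (Fintype.card (DegIdx (Fin (n + 2)) D) : WithBot ℕ∞) := by
      rw [← hdim]; push_cast; rfl
    exact_mod_cast this
  have h2 : Fintype.card (UVars n D) ≤ s := by exact_mod_cast hlow
  have h3 : h ≤ 1 := by omega
  exact_mod_cast h3

/-- **The discriminant locus is an irreducible hypersurface: `height I_S = 1`** (parts I + II).
[cite: GelfandKapranovZelevinsky1994, Ch. 1 §1 (the discriminant hypersurface)] -/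
theorem height_ker_singFamily_eq_one (hD : 2 ≤ D) :
    (RingHom.ker (aeval (R := ℂ) (singFamilyCoeff (n := n) (D := D))).toRingHom).height = 1 := by
  refine le_antisymm (height_ker_singFamily_le_one hD) ?_
  rw [Order.one_le_iff_ne_zero, Ne, Ideal.height_eq_zero_iff_eq_bot]
  exact ker_singFamily_ne_bot hD

end Height

/-! ### The discriminant exists (unconditional forms of the packaged statements) -/

section Discriminant

/-- **Existence of the discriminant.** For `D ≥ 2` there is a non-zero `SL_{n+2}`-invariant
polynomial function `Δ` on `Sym^D ℂ^{n+2}` such that, for every form `F` of degree `D`, `Δ(F) = 0`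
iff `F` is not nonsingular (the cell-bus signature of programme «`BI2017_prop_2_10` Popov-free»,
brick (3); `exists_discriminant_form` with its height hypothesis discharged).
[cite: MumfordFogartyKirwan1994, Chap. 4 §2 Prop. 4.2 (proof)] -/
theorem exists_discriminant (hD : 2 ≤ D) :
    ∃ Δ : MvPolynomial (DegIdx (Fin (n + 2)) D) ℂ, Δ ≠ 0 ∧ IsSLInvariantCoord D Δ ∧
      ∀ F : MvPolynomial (Fin (n + 2)) ℂ, F.IsHomogeneous D →
        (aeval (formCoeff D F) Δ = 0 ↔ ¬ IsNonsingularForm ℂ F) :=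
  exists_discriminant_form hD (height_ker_singFamily_le_one hD)

/-- **The discriminant is irreducible**: `Δ` may be taken prime, generating both `I_S` and the
vanishing ideal of the singular forms of degree `D`.
[cite: GelfandKapranovZelevinsky1994, Ch. 1 §1 (the discriminant hypersurface)] -/
theorem exists_prime_discriminant (hD : 2 ≤ D) :
    ∃ Δ : MvPolynomial (DegIdx (Fin (n + 2)) D) ℂ, Prime Δ ∧ IsSLInvariantCoord D Δ ∧
      RingHom.ker (aeval (R := ℂ) (singFamilyCoeff (n := n) (D := D))).toRingHom = Ideal.span {Δ} ∧
      MvPolynomial.vanishingIdeal ℂ (formCoeff D ''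
        {F : MvPolynomial (Fin (n + 2)) ℂ | F.IsHomogeneous D ∧ ¬ IsNonsingularForm ℂ F}) =
          Ideal.span {Δ} ∧
      ∀ F : MvPolynomial (Fin (n + 2)) ℂ, F.IsHomogeneous D →
        (aeval (formCoeff D F) Δ = 0 ↔ ¬ IsNonsingularForm ℂ F) :=
  exists_prime_discriminant_form hD (height_ker_singFamily_le_one hD)

/-- **The discriminant, Mumford–Fogarty–Kirwan's form**: a non-zero polynomial function on
`Sym^D ℂ^{n+2}` (`D ≥ 2`), homogeneous of some positive degree, `SL_{n+2}`-invariant, vanishing at a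
form `f` of degree `D` iff `f` is not nonsingular («a definite homogeneous polynomial `Δ` in its
coefficients … `Δ` must be invariant»; `exists_isSLInvariantCoord_discriminant` with its height
hypothesis discharged). [cite: MumfordFogartyKirwan1994, Chap. 4 §2 Prop. 4.2 (proof)] -/
theorem exists_homogeneous_isSLInvariantCoord_discriminant (n D : ℕ) (hD : 2 ≤ D) :
    ∃ q : MvPolynomial (DegIdx (Fin (n + 2)) D) ℂ, q ≠ 0 ∧ (∃ e, 0 < e ∧ q.IsHomogeneous e) ∧
      IsSLInvariantCoord D q ∧
      ∀ f : MvPolynomial (Fin (n + 2)) ℂ, f.IsHomogeneous D →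
        (aeval (formCoeff D f) q = 0 ↔ ¬ IsNonsingularForm ℂ f) :=
  exists_isSLInvariantCoord_discriminant n D hD (height_ker_singFamily_le_one hD)

/-- **The discriminant, full dossier**: prime, homogeneous of positive degree, `SL`-invariant,
generating `I_S` and the vanishing ideal of the singular forms, with zero set exactly the singular
forms of degree `D ≥ 2`. [cite: GelfandKapranovZelevinsky1994, Ch. 1 §1 (the discriminant hypersurface)] -/
theorem exists_prime_isHomogeneous_discriminant (hD : 2 ≤ D) :
    ∃ Δ : MvPolynomial (DegIdx (Fin (n + 2)) D) ℂ, Prime Δ ∧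
      Δ.IsHomogeneous Δ.totalDegree ∧ 0 < Δ.totalDegree ∧ IsSLInvariantCoord D Δ ∧
      RingHom.ker (aeval (R := ℂ) (singFamilyCoeff (n := n) (D := D))).toRingHom = Ideal.span {Δ} ∧
      MvPolynomial.vanishingIdeal ℂ (formCoeff D ''
        {F : MvPolynomial (Fin (n + 2)) ℂ | F.IsHomogeneous D ∧ ¬ IsNonsingularForm ℂ F}) =
          Ideal.span {Δ} ∧
      ∀ F : MvPolynomial (Fin (n + 2)) ℂ, F.IsHomogeneous D →
        (aeval (formCoeff D F) Δ = 0 ↔ ¬ IsNonsingularForm ℂ F) :=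
  exists_prime_isHomogeneous_discriminant_form hD (height_ker_singFamily_le_one hD)

end Discriminant

end FormDiscriminant

end Literature.Computability.AlgebraicComplexity

end
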